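import Summits.NavierStokesRegularity.NavierStokesRegularity.Theorems.ClockStretchingLawClockCeilingFarPastStretchingRung
import Summits.NavierStokesRegularity.NavierStokesRegularity.Theorems.ClockStretchingLawClockCeilingSingularStretchingNearZero
import Summits.NavierStokesRegularity.NavierStokesRegularity.Theorems.SqueezeCycleSingularZoomExtraction
import Summits.NavierStokesRegularity.NavierStokesRegularity.Theorems.SqueezeCycleExtremalElementExistsRescale
import Literature.Analysis.FluidPDE.DirectionDissipation
import Literature.Analysis.FluidPDE.TaoEnstrophyLocalisation
import Literature.Analysis.FluidPDE.Vorticity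
import Literature.Analysis.FluidPDE.TypeIAncientMild
import HarnessLib

/-!
# Route ClockStretchingLaw, crux `ClockCeiling` (stmt-NavierStokesRegularity-10570), line `registered` —
# dynamical law: VELOCITY CONCENTRATION FORCES NEAR-CRITICAL GAUGE VORTEX STRETCHING in a backward
# parabolic box of bounded size

`stub_velocityForcesStretching`: for every Type-I constant `C`, every level `θ > 0` and every
sub-critical rate `θ' < 1` there are `L = L(C, θ, θ') ≥ 1` and `R = R(C, θ, θ') > 0` such that for
EVERY element `u` of the Type-I ancient mild class `A_C` (`IsTypeIAncientMild C u`: jointly smooth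
on `t < 0`, divergence free, KNSS/Oseen mild between all pairs `s < t < 0`, `‖u(t,x)‖ ≤ C/√(−t)`),
every `t < 0` and every `x`: if `√(−t)‖u(t, x)‖ ≥ θ` then somewhere in the backward space–time box
`[L t, t] × B(x, R√(−t))` the vorticity is nonzero and the gauge stretching rate along the
vorticity direction `ξ = ω/‖ω‖` exceeds `θ'`: `(−s)⟪∇u(s, x') ξ, ξ⟫ > θ'`. The law is uniform
over the class and scale invariant; the constants come from compactness and are not explicit.

## Proof (contradiction + zoom + compactness + the far-past stretching rung)

If not, for `L = R = k+1` there are `u_k ∈ A_C`, `t_k < 0`, `x_k` with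
`√(−t_k)‖u_k(t_k, x_k)‖ ≥ θ` but gauge stretching `≤ θ'` wherever the vorticity is nonzero in
`[(k+1) t_k, t_k] × B(x_k, (k+1)√(−t_k))`. The Navier–Stokes zoom
`v_k(s, y) = c_k u_k(c_k² s, x_k + c_k y)`, `c_k = √(−t_k)`, is again in `A_C`
(`isTypeIAncientMild_zoom`) with `‖v_k(−1, 0)‖ ≥ θ`; its vorticity is `c_k² ω_k(c_k² s, x_k + c_k y)`
(`curl_smul_stPull`) and the gauge stretching rate is ZOOM INVARIANT
(`gaugeStretching_nsZoom_centre`), so `v_k` has stretching `≤ θ'` wherever its vorticity is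
nonzero in `[−(k+1), −1] × B(0, k+1)`. KNSS compactness of the class on growing windows
(`exists_tendsto_of_typeI_seq_Ioo`) extracts a limit `W ∈ A_C` with pointwise convergence of
values and gradients at every `s < 0`: `‖W(−1, 0)‖ ≥ θ > 0`, and at every `(s, y)` with `s < −1`
and `curl W(s, y) ≠ 0` the curls (continuity of `curlCLM`), the directions `ξ = ‖ω‖⁻¹ ω` and the
stretching rates of `v_{φ(j)}` converge to those of `W`, while `(s, y)` is eventually inside the
zoomed box; hence `(−s)⟪∇W ξ, ξ⟫ ≤ θ'` on the whole end `s < −1`. The far-past stretching rung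
(`farPastStretchingRung`, `T = −1`: stretching `≤ θ' < 1` on a backward end kills a class
element) gives `W ≡ 0` — contradiction.

## References

* G. Koch, N. Nadirashvili, G. Seregin, V. Šverák, *Liouville theorems for the Navier–Stokes
  equations and applications*, Acta Math. 203 (2009) 83–105 = arXiv:0709.3599, §1 (1.2),
  Lemma 3.1, Prop. 4.1, Remark 6.1. [KochNadirashviliSereginSverak2009]
* P. Constantin, C. Fefferman, Indiana Univ. Math. J. 42 (1993) 775–789, §1 (the stretching rate
  `α = ⟪Sξ, ξ⟫`). [ConstantinFefferman1993]
-/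

noncomputable section

-- the summit and its single sub-problem share the name (CONVENTIONS §1), as in every Theorems file
set_option linter.dupNamespace false

namespace Summit.NavierStokesRegularity.NavierStokesRegularity.Theorems

open MeasureTheory Set Function Filter Topology
open scoped RealInnerProductSpace
open Literature.Analysis Literature.Analysis.FluidPDE

section VelocityForcesStretching

variable {C : ℝ} {u : ℝ → EuclideanSpace ℝ (Fin 3) → EuclideanSpace ℝ (Fin 3)}

/-- **Gradient of the Navier–Stokes zoom about `(0, x₀)`**:
`∇(c u(c²t, x₀ + c ·))(x) = c² ∇u(c²t)(x₀ + c x)` (chain rule for the homothety; no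
differentiability needed, `fderiv_stPull`). [folklore] -/
theorem fderiv_nsZoom_centre (c : ℝ) (x₀ : EuclideanSpace ℝ (Fin 3))
    (u : ℝ → EuclideanSpace ℝ (Fin 3) → EuclideanSpace ℝ (Fin 3)) (t : ℝ)
    (x : EuclideanSpace ℝ (Fin 3)) :
    fderiv ℝ ((c • stPull (c ^ 2) c 0 x₀ u) t) x =
      (c * c) • fderiv ℝ (u (c ^ 2 * t)) (x₀ + c • x) := by
  have h1 : (c • stPull (c ^ 2) c 0 x₀ u) t = c • stPull (c ^ 2) c 0 x₀ u t := rfl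
  rw [h1, fderiv_const_smul_field, Pi.smul_apply, fderiv_stPull, smul_smul, zero_add]

/-- **Curl of the Navier–Stokes zoom about `(0, x₀)`**:
`curl(c u(c²t, x₀ + c ·))(x) = c² ω(c²t, x₀ + c x)` (`curl_smul_stPull`). [folklore] -/
theorem curl_nsZoom_centre (c : ℝ) (x₀ : EuclideanSpace ℝ (Fin 3))
    (u : ℝ → EuclideanSpace ℝ (Fin 3) → EuclideanSpace ℝ (Fin 3)) (t : ℝ)
    (x : EuclideanSpace ℝ (Fin 3)) :
    curl ((c • stPull (c ^ 2) c 0 x₀ u) t) x = (c * c) • curl (u (c ^ 2 * t)) (x₀ + c • x) := by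
  rw [curl_smul_stPull, zero_add]

/-- **The vorticity direction is zoom invariant**: `ξ_c(t, x) = ξ(c²t, x₀ + c x)` for the zoom
`u_c = c u(c² ·, x₀ + c ·)`, `0 < c` (the direction of a positive multiple). [folklore] -/
theorem vorticityDirection_nsZoom_centre {c : ℝ} (hc : 0 < c) (x₀ : EuclideanSpace ℝ (Fin 3))
    (u : ℝ → EuclideanSpace ℝ (Fin 3) → EuclideanSpace ℝ (Fin 3)) (t : ℝ)
    (x : EuclideanSpace ℝ (Fin 3)) :
    vorticityDirection (curl ((c • stPull (c ^ 2) c 0 x₀ u) t)) x =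
      vorticityDirection (curl (u (c ^ 2 * t))) (x₀ + c • x) := by
  rw [vorticityDirection_apply, vorticityDirection_apply, curl_nsZoom_centre,
    inv_norm_smul_smul_of_pos (mul_pos hc hc)]

/-- **The gauge stretching rate along the vorticity direction is zoom invariant** (general
centre): for the zoom `u_c = c u(c² ·, x₀ + c ·)` (`0 < c`),
`(−t)⟪∇u_c(t,x) ξ_c, ξ_c⟫ = (−c²t)⟪∇u(c²t, x₀ + cx) ξ, ξ⟫` with `ξ_c(t,x) = ξ(c²t, x₀ + cx)`
(KNSS 2009 §1 (1.2): the scaling symmetry). [cite: KochNadirashviliSereginSverak2009, §1 (1.2) (arXiv:0709.3599)] -/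
theorem gaugeStretching_nsZoom_centre {c : ℝ} (hc : 0 < c) (x₀ : EuclideanSpace ℝ (Fin 3))
    (u : ℝ → EuclideanSpace ℝ (Fin 3) → EuclideanSpace ℝ (Fin 3)) (t : ℝ)
    (x : EuclideanSpace ℝ (Fin 3)) :
    (-t) * ⟪fderiv ℝ ((c • stPull (c ^ 2) c 0 x₀ u) t) x
        (vorticityDirection (curl ((c • stPull (c ^ 2) c 0 x₀ u) t)) x),
        vorticityDirection (curl ((c • stPull (c ^ 2) c 0 x₀ u) t)) x⟫ =
      (-(c ^ 2 * t)) * ⟪fderiv ℝ (u (c ^ 2 * t)) (x₀ + c • x)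
        (vorticityDirection (curl (u (c ^ 2 * t))) (x₀ + c • x)),
        vorticityDirection (curl (u (c ^ 2 * t))) (x₀ + c • x)⟫ := by
  rw [vorticityDirection_nsZoom_centre hc, fderiv_nsZoom_centre, _root_.smul_apply,
    real_inner_smul_left]
  ring

/-- **The Navier–Stokes zoom to unit scale about a concentration point.** For `u ∈ A_C`, `t < 0`
and a centre `x`, the zoom `v(s, y) = c u(c² s, x + c y)`, `c = √(−t)`, is an element of `A_C`
(`isTypeIAncientMild_zoom`, KNSS 2009 §1 (1.2)) with `‖v(−1, 0)‖ = √(−t)‖u(t, x)‖`,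
`curl v(s, y) = (−t) curl u((−t)s, x + c y)` (`curl_smul_stPull`) and the SAME gauge stretching
rate along the vorticity direction as `u` at the corresponding point
(`gaugeStretching_nsZoom_centre`). [cite: KochNadirashviliSereginSverak2009, §1 (1.2) (arXiv:0709.3599 p. 2)] -/
theorem velocityForcesStretching_zoom (hu : IsTypeIAncientMild C u) {t : ℝ} (ht : t < 0)
    (x : EuclideanSpace ℝ (Fin 3)) :
    ∃ v : ℝ → EuclideanSpace ℝ (Fin 3) → EuclideanSpace ℝ (Fin 3), IsTypeIAncientMild C v ∧
      ‖v (-1) 0‖ = Real.sqrt (-t) * ‖u t x‖ ∧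
      (∀ s y, curl (v s) y = (-t) • curl (u ((-t) * s)) (x + Real.sqrt (-t) • y)) ∧
      ∀ s y, (-s) * ⟪fderiv ℝ (v s) y (vorticityDirection (curl (v s)) y),
          vorticityDirection (curl (v s)) y⟫ =
        (-((-t) * s)) * ⟪fderiv ℝ (u ((-t) * s)) (x + Real.sqrt (-t) • y)
          (vorticityDirection (curl (u ((-t) * s))) (x + Real.sqrt (-t) • y)),
          vorticityDirection (curl (u ((-t) * s))) (x + Real.sqrt (-t) • y)⟫ := by
  set c : ℝ := Real.sqrt (-t) with hcdef
  have hc : 0 < c := Real.sqrt_pos.2 (neg_pos.2 ht)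
  have hc2 : c ^ 2 = -t := Real.sq_sqrt (neg_pos.2 ht).le
  refine ⟨c • stPull (c ^ 2) c 0 x u, isTypeIAncientMild_zoom hu hc x, ?_, fun s y => ?_,
    fun s y => ?_⟩
  · rw [zoom_apply, mul_neg_one, hc2, neg_neg, smul_zero, add_zero, norm_smul,
      Real.norm_of_nonneg hc.le]
  · rw [curl_nsZoom_centre, ← sq, hc2]
  · rw [gaugeStretching_nsZoom_centre hc, hc2]

/-- **Velocity concentration forces near-critical gauge vortex stretching in a backward parabolic
box of bounded size (uniformly over the Type-I ancient mild class).** For every `C`, `θ > 0` and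
`θ' < 1` there are `L ≥ 1` and `R > 0` such that for every `u ∈ A_C`, every `t < 0` and every `x`
with `θ ≤ √(−t)‖u(t, x)‖` some `s ∈ [L t, t]` and some `x' ∈ B(x, R√(−t))` have
`curl u(s, x') ≠ 0` and `θ' < (−s)⟪∇u(s, x') ξ, ξ⟫`. By contradiction: zoom the violating data to
unit scale (`velocityForcesStretching_zoom`), extract a limit in the class
(`exists_tendsto_of_typeI_seq_Ioo`) which has norm `≥ θ` at `(−1, 0)` but gauge stretching
`≤ θ'` wherever its vorticity is nonzero on the end `s < −1` (convergence of gradients, curls,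
directions and stretching rates), against the far-past stretching rung `farPastStretchingRung`.
[cite: KochNadirashviliSereginSverak2009, Lemma 3.1, Prop. 4.1 and Remark 6.1 (arXiv:0709.3599)] -/
theorem velocityForcesStretching (C : ℝ) {θ θ' : ℝ} (hθ : 0 < θ) (hθ' : θ' < 1) :
    ∃ L ≥ (1 : ℝ), ∃ R > 0,
      ∀ u : ℝ → EuclideanSpace ℝ (Fin 3) → EuclideanSpace ℝ (Fin 3), IsTypeIAncientMild C u →
        ∀ t < 0, ∀ x : EuclideanSpace ℝ (Fin 3), θ ≤ Real.sqrt (-t) * ‖u t x‖ →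
          ∃ s ∈ Icc (L * t) t, ∃ x' ∈ Metric.ball x (R * Real.sqrt (-t)),
            curl (u s) x' ≠ 0 ∧
              θ' < (-s) * ⟪fderiv ℝ (u s) x' (vorticityDirection (curl (u s)) x'),
                vorticityDirection (curl (u s)) x'⟫ := by
  by_contra h
  push Not at h
  -- violating data at box size `n+1`
  have hseq : ∀ n : ℕ, ∃ u : ℝ → EuclideanSpace ℝ (Fin 3) → EuclideanSpace ℝ (Fin 3),
      IsTypeIAncientMild C u ∧ ∃ t, t < 0 ∧ ∃ x : EuclideanSpace ℝ (Fin 3),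
        θ ≤ Real.sqrt (-t) * ‖u t x‖ ∧
        ∀ s ∈ Icc (((n : ℝ) + 1) * t) t,
          ∀ x' ∈ Metric.ball x (((n : ℝ) + 1) * Real.sqrt (-t)), curl (u s) x' ≠ 0 →
            (-s) * ⟪fderiv ℝ (u s) x' (vorticityDirection (curl (u s)) x'),
              vorticityDirection (curl (u s)) x'⟫ ≤ θ' :=
    fun n => h _ (le_add_of_nonneg_left (Nat.cast_nonneg n)) _ (Nat.cast_add_one_pos n)
  choose u hu t ht x hx hsm using hseq
  -- zoom to unit scale around the concentration points
  choose v hv hv0 hvcurl hvstr using fun n => velocityForcesStretching_zoom (hu n) (ht n) (x n)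
  -- compactness on the growing windows `(-(k+1), 0)`
  set A : ℕ → ℝ := fun k => -((k : ℝ) + 1)
  have hAt : Tendsto A atTop atBot :=
    tendsto_neg_atTop_atBot.comp (tendsto_natCast_atTop_atTop.atTop_add tendsto_const_nhds)
  have hcont : ∀ k, ContinuousOn (uncurry (v k)) (Ioo (A k) 0 ×ˢ univ) := fun k =>
    (hv k).continuousOn_uncurry.mono (prod_mono (fun t ht => ht.2) subset_rfl)
  have hdivw : ∀ k, ∀ t ∈ Ioo (A k) 0, IsWeaklyDivFree (v k t) := fun k t ht =>
    (hv k).isWeaklyDivFree ht.2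
  have hmild : ∀ k, ∀ s t : ℝ, A k < s → s < t → t < 0 → ∀ x,
      v k t x = UnboundedOperators.heatExtension (v k s) (t - s) x -
        oseenDuhamel 1 s (v k) (v k) t x :=
    fun k s t _ hst ht x => (hv k).mild_eq_heatExtension hst ht x
  have hI : ∀ k, ∀ t ∈ Ioo (A k) 0, ∀ x, ‖v k t x‖ ≤ C / Real.sqrt (-t) := fun k t ht x =>
    (hv k).norm_le ht.2 x
  obtain ⟨φ, hφ, W, hW, hpt, hptG, -, -⟩ :=
    exists_tendsto_of_typeI_seq_Ioo C hAt hcont hdivw hmild hI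
  -- the limit has norm `≥ θ` at `(-1, 0)`
  have hW0 : θ ≤ ‖W (-1) 0‖ := by
    refine ge_of_tendsto (hpt (-1) (by norm_num) 0).norm (Eventually.of_forall fun j => ?_)
    rw [hv0 (φ j)]
    exact hx (φ j)
  -- its gauge stretching is `≤ θ'` wherever the vorticity is nonzero on the end `s < -1`
  have HW : ∀ s < -1, ∀ y, curl (W s) y ≠ 0 →
      (-s) * ⟪fderiv ℝ (W s) y (vorticityDirection (curl (W s)) y),
        vorticityDirection (curl (W s)) y⟫ ≤ θ' := by
    intro s hs y hωW
    have hs0 : s < 0 := by linarith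
    -- gradients, curls, directions and stretching rates converge at `(s, y)`
    have hgrad : Tendsto (fun j => fderiv ℝ (v (φ j) s) y) atTop (𝓝 (fderiv ℝ (W s) y)) :=
      hptG s hs0 y
    have hcurl : Tendsto (fun j => curl (v (φ j) s) y) atTop (𝓝 (curl (W s) y)) := by
      simp only [curl_eq_curlCLM]
      exact (curlCLM.continuous.tendsto _).comp hgrad
    have hne : ∀ᶠ j in atTop, curl (v (φ j) s) y ≠ 0 := hcurl.eventually_ne hωW
    have hξ : Tendsto (fun j => vorticityDirection (curl (v (φ j) s)) y) atTop
        (𝓝 (vorticityDirection (curl (W s)) y)) := by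
      simp only [vorticityDirection_apply]
      exact ((hcurl.norm).inv₀ (norm_ne_zero_iff.2 hωW)).smul hcurl
    have happ : Tendsto (fun j => fderiv ℝ (v (φ j) s) y (vorticityDirection (curl (v (φ j) s)) y))
        atTop (𝓝 (fderiv ℝ (W s) y (vorticityDirection (curl (W s)) y))) :=
      ((isBoundedBilinearMap_apply (𝕜 := ℝ) (E := EuclideanSpace ℝ (Fin 3))
        (F := EuclideanSpace ℝ (Fin 3))).continuous.tendsto
          (fderiv ℝ (W s) y, vorticityDirection (curl (W s)) y)).comp (hgrad.prodMk_nhds hξ)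
    have hstr : Tendsto (fun j => (-s) * ⟪fderiv ℝ (v (φ j) s) y
        (vorticityDirection (curl (v (φ j) s)) y), vorticityDirection (curl (v (φ j) s)) y⟫)
        atTop (𝓝 ((-s) * ⟪fderiv ℝ (W s) y (vorticityDirection (curl (W s)) y),
          vorticityDirection (curl (W s)) y⟫)) :=
      (happ.inner hξ).const_mul (-s)
    -- `(s, y)` is eventually inside the zoomed box `[-(φ j + 1), -1] × B(0, φ j + 1)`
    have hevs : ∀ᶠ j : ℕ in atTop, -((φ j : ℝ) + 1) ≤ s := by
      obtain ⟨N, hN⟩ := exists_nat_gt (-s)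
      refine (eventually_ge_atTop N).mono fun j hj => ?_
      have hNj : (N : ℝ) ≤ φ j := by exact_mod_cast hj.trans hφ.le_apply
      linarith
    have hevy : ∀ᶠ j : ℕ in atTop, ‖y‖ < (φ j : ℝ) + 1 := by
      obtain ⟨N, hN⟩ := exists_nat_gt ‖y‖
      refine (eventually_ge_atTop N).mono fun j hj => hN.trans ?_
      exact_mod_cast Nat.lt_succ_of_le (hj.trans hφ.le_apply)
    have hev : ∀ᶠ j in atTop, (-s) * ⟪fderiv ℝ (v (φ j) s) y
        (vorticityDirection (curl (v (φ j) s)) y), vorticityDirection (curl (v (φ j) s)) y⟫ ≤ θ' := by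
      filter_upwards [hne, hevs, hevy] with j hj hjs hjy
      have htn : 0 < -t (φ j) := neg_pos.2 (ht (φ j))
      have hc : 0 < Real.sqrt (-t (φ j)) := Real.sqrt_pos.2 htn
      -- the corresponding point of `u (φ j)` lies in its box
      have hsmem : (-t (φ j)) * s ∈ Icc (((φ j : ℝ) + 1) * t (φ j)) (t (φ j)) := by
        constructor
        · nlinarith [mul_nonneg htn.le (by linarith : (0 : ℝ) ≤ s + ((φ j : ℝ) + 1))]
        · nlinarith [mul_nonneg htn.le (by linarith : (0 : ℝ) ≤ -1 - s)]
      have hxmem : x (φ j) + Real.sqrt (-t (φ j)) • y ∈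
          Metric.ball (x (φ j)) (((φ j : ℝ) + 1) * Real.sqrt (-t (φ j))) := by
        rw [mem_ball_iff_norm, add_sub_cancel_left, norm_smul, Real.norm_of_nonneg hc.le,
          mul_comm]
        exact mul_lt_mul_of_pos_right hjy hc
      -- nonzero vorticity of `u (φ j)` at the corresponding point
      have hω' : curl (u (φ j) ((-t (φ j)) * s)) (x (φ j) + Real.sqrt (-t (φ j)) • y) ≠ 0 := by
        intro h0
        apply hj
        rw [hvcurl (φ j), h0, smul_zero]
      rw [hvstr (φ j)]
      exact hsm (φ j) _ hsmem _ hxmem hω'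
    exact le_of_tendsto hstr hev
  -- the far-past stretching rung kills the limit: contradiction with the level `θ` at `(-1, 0)`
  have hWz : W (-1) 0 = 0 :=
    farPastStretchingRung hW (T := -1) (by norm_num) hθ' HW (-1) (by norm_num) 0
  rw [hWz, norm_zero] at hW0
  exact absurd hW0 (not_le.2 hθ)

end VelocityForcesStretching

/-- **Stub `stub_velocityForcesStretching` (crux stmt-NavierStokesRegularity-10570, line
`registered`, dynamical structural law of the class)**: VELOCITY CONCENTRATION FORCES NEAR-CRITICAL
GAUGE VORTEX STRETCHING, uniformly over the Type-I ancient mild class — for every `C`, `θ > 0` and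
`θ' < 1` there are `L ≥ 1`, `R > 0` such that for every `u` with `IsTypeIAncientMild C u`, every
`t < 0` and every `x` with `θ ≤ √(−t)‖u(t, x)‖`, some `s ∈ [L t, t]` and `x' ∈ B(x, R√(−t))` have
`curl u(s, x') ≠ 0` and `θ' < (−s)⟪∇u(s, x') ξ, ξ⟫`, `ξ = ω/‖ω‖` (zoom + KNSS compactness + the
far-past stretching rung kills the limit; `velocityForcesStretching`).
[cite: KochNadirashviliSereginSverak2009, Lemma 3.1, Prop. 4.1 and Remark 6.1 (arXiv:0709.3599)] -/
theorem stub_velocityForcesStretching : ∀ (C θ θ' : ℝ), 0 < θ → θ' < 1 → ∃ L ≥ (1 : ℝ), ∃ R > 0, ∀ u : ℝ → EuclideanSpace ℝ (Fin 3) → EuclideanSpace ℝ (Fin 3), Literature.Analysis.FluidPDE.IsTypeIAncientMild C u → ∀ t < 0, ∀ x : EuclideanSpace ℝ (Fin 3), θ ≤ Real.sqrt (-t) * ‖u t x‖ → ∃ s ∈ Set.Icc (L * t) t, ∃ x' ∈ Metric.ball x (R * Real.sqrt (-t)), Literature.Analysis.FluidPDE.curl (u s) x' ≠ 0 ∧ θ'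 < (-s) * inner ℝ (fderiv ℝ (u s) x' (Literature.Analysis.FluidPDE.vorticityDirection (Literature.Analysis.FluidPDE.curl (u s)) x')) (Literature.Analysis.FluidPDE.vorticityDirection (Literature.Analysis.FluidPDE.curl (u s)) x') :=
  fun C _ _ hθ hθ' => velocityForcesStretching C hθ hθ'

end Summit.NavierStokesRegularity.NavierStokesRegularity.Theorems

end
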